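import Summits.Ventures.PercRepro2.CaseOneGadgetUWOPin
import Summits.Ventures.PercRepro2.CaseOneGlued
import Summits.Ventures.PercRepro2.CaseOneRootsAndOQ

/-!
# The gadget `u ~ {w, o}`, `w ~ {u, a₁, a₂, b}` (uwo): the top face in `e(w–a₁)` is a glued roots-and-`o` instance
(blind cell PercRepro2, p1 g25; S5 §2.1 (K9) — the `(i)` / `(i-Q)` half of the uwo row by the face induction of
P1-FACE §4; own code)

The `(i)` / `(i-Q)` certificates of the uwo gadget fail only at Bernstein index `3` in `e₂ = e(w–a₁)`
(data/p1/g16/gadget/uwo_fails.json: 2 / 5 coefficients, exact Farkas obstructions), so the face induction keeps that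
face as the instance `p(w–a₁) = 1`: `w` glued to the root `a₁`, the statement vertex `u` adjacent to the glued vertex
and to `o`. Four lemmas make that instance a class theorem of the tree: **`zSplitI_of_rootsAndO_glued₁`** /
**`zSplitIQ_of_rootsAndO_glued₁`** compose the glue transfer `zSplitI_glue₁` / `zSplitIQ_glue₁` (CaseOneGlued.lean)
with the roots-and-`o` class theorems `zSplitI_of_rootsAndO` / `zSplitIQ_of_rootsAndO` (CaseOneRootsAndOI / OQ.lean),
exactly as `zSplitII_of_rootsAndO_glued₁` does for `(ii)`; `gadgetUWO_rootsAndO` is their `hroot` hypothesis read off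
the gadget (every edge at `u` other than `euo` is `euw`); and `pin5O_update_wa1` — pinning the five gadget edges forgets
a prior update of `e(w–a₁)`, so the cell masses of the glued instance `p[ewa1 ↦ 1]` are those of `p`. With the bridges
`iExpr_eq_iO5` / `iExprT_eq_iqO5` (CaseOneGadgetUWOBridge.lean) they turn the class theorem at the glued instance into
the face value `iO5(e₂ := 1) ≥ 0` / `iqO5(e₂ := 1) ≥ 0` of the gadget polynomials. -/

namespace Summit.Ventures.PercRepro2

namespace CaseOne

section FaceO5
variable {V : Type*} {E : Type*} [Fintype E] [DecidableEq E] {R : Type*} [CommRing R]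
variable {ends : E → Sym2 V} {o a₁ a₂ b u w : V} {euw euo ewa1 ewa2 ewb : E}

omit [Fintype E] [DecidableEq E] in
/-- In the gadget every edge at `u` other than `euo` goes to `w`: the `hroot` hypothesis of the glued
roots-and-`o` class theorems at `a₃ = u`, with `w` in the role of the glued root. -/
lemma gadgetUWO_rootsAndO (h : IsGadgetUWO ends o a₁ a₂ b u w euw euo ewa1 ewa2 ewb) :
    ∀ e', u ∈ ends e' → e' ≠ euo → ends e' = s(w, u) ∨ ends e' = s(a₂, u) := by
  intro e' he' hne
  rcases h.unique_u e' he' with rfl | rfl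
  · exact Or.inl h.ends_uw
  · exact absurd rfl hne

omit [Fintype E] in
/-- Pinning the five gadget edges forgets a prior update of `e(w–a₁)`. -/
lemma pin5O_update_wa1 (p : E → R) (c : R) :
    pin5O (Function.update p ewa1 c) euw euo ewa1 ewa2 ewb = pin5O p euw euo ewa1 ewa2 ewb := by
  funext x
  unfold pin5O
  by_cases hx : x = ewa1
  · subst hx
    simp [Function.update_apply]
  · simp [Function.update_apply, hx]

end FaceO5

section GluedO5
variable {V : Type*} {E : Type*} [Fintype E] [DecidableEq E] [Fintype V] [DecidableEq V]
  {R : Type*} [Field R] [LinearOrder R] [IsStrictOrderedRing R]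
variable {ends : E → Sym2 V} {a₁ a₂ a₃ w : V} {e : E}

/-- **`(i)` for `a₃` adjacent to `w`, to `a₂` and to `o`, with `w` glued to the root `a₁`** by an edge of
weight `1` (the face `e(w–a₁) = 3` of a gadget whose statement vertex sees the glued vertex and `o`). -/
theorem zSplitI_of_rootsAndO_glued₁ (p : E → R) (hp : IsProbVec p) (he : p e = 1)
    (hends : ends e = s(a₁, w)) {e₀ : E} {o : V} (he₀ : ends e₀ = s(o, a₃))
    (hroot : ∀ e', a₃ ∈ ends e' → e' ≠ e₀ → ends e' = s(w, a₃) ∨ ends e' = s(a₂, a₃))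
    (ho : o ≠ a₃) (hw : w ≠ a₃) {b : V} (hb : b ≠ a₃) :
    ZSplitI p ends o a₁ a₂ a₃ b :=
  (zSplitI_glue₁ he hends o a₂ a₃ b).2 (zSplitI_of_rootsAndO p hp he₀ hroot ho hw hb)

/-- **`(i-Q)` for `a₃` adjacent to `w`, to `a₂` and to `o`, with `w` glued to the root `a₁`.** -/
theorem zSplitIQ_of_rootsAndO_glued₁ (p : E → R) (hp : IsProbVec p) (he : p e = 1)
    (hends : ends e = s(a₁, w)) {e₀ : E} {o : V} (he₀ : ends e₀ = s(o, a₃))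
    (hroot : ∀ e', a₃ ∈ ends e' → e' ≠ e₀ → ends e' = s(w, a₃) ∨ ends e' = s(a₂, a₃))
    (ho : o ≠ a₃) (hw : w ≠ a₃) {b : V} (hb : b ≠ a₃) :
    ZSplitIQ p ends o a₁ a₂ a₃ b :=
  (zSplitIQ_glue₁ he hends o a₂ a₃ b).2 (zSplitIQ_of_rootsAndO p hp he₀ hroot ho hw hb)

end GluedO5

end CaseOne

end Summit.Ventures.PercRepro2
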